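import Literature.MathematicalPhysics.QuantumFieldTheory.Balaban1983to89.B9WalkLettersKernelsStatic
import Literature.MathematicalPhysics.QuantumFieldTheory.Balaban1983to89.B9WalkLettersCoordsDom

/-!
# `Balaban1983to89.B9WalkLettersKernelsDom` — W-a FILE C-2 (part 2b, proofs II): THE EIGHT DOMINATIONS `Identities₂.hP ∕ hPt ∕ hPL ∕ hC ∕ hCt ∕ hCL ∕ hCD ∕ hCLt`
# OF THE rows-18 WALK LETTERS (3.87)–(3.90) BY THE KERNELS OF RECORD (`B9WalkLettersKernels`) on the certificate's site pin

statement-level skeleton of published theorems with citation tags; proofs where landed; nothing here is a claim about the Yang–Mills mass gap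

B9 = T. Bałaban, *Propagators for lattice gauge theories in a background field*, Commun. Math. Phys. **99** (1985) 389–434 [Balaban1985BackgroundPropagators];
[4] = T. Bałaban, *Propagators and renormalization transformations for lattice gauge theories. II*, Commun. Math. Phys. **96** (1984) 223–250 [Balaban1984PropagatorsII].
THE PRINT.  (3.88)–(3.89) p.409 (the letters of `K(h_□)` and their transposes), (3.100) p.413 (the Leibniz rules of `∇_U`, `Δ_U` through `M_h`); [4] (2.39)–(2.40)
pp.229–230, (2.51) p.232 (the block-majorant currency «|(Tλ)(x)| ≦ K(y, y′)|λ|, x ∈ Δ(y), supp λ ⊂ Δ(y′)»).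
WHY THIS FILE (pub-ymgap, dag-n06-d W-a C-2 programme).  The N06 certificate's schema `h36 : … → Local342 … ∧ Identities₂ (𝔬 x) (𝔡 x) (𝔩 x) 1 (H x) U` asks, letter by
letter, for a block majorant of the rows-18 walk letters by the kernels of the `Ops ∕ DirLetters37` records.  Part 2a (`B9WalkLettersCoordsDom`) proved them for ANY
kernel `K` under a displayed `hK`; part 2b-I (`B9WalkLettersKernelsStatic`) proved the stencil facts of `h_□` on the site pin; THIS FILE puts the two together at the
KERNELS OF RECORD `kPdY kPtdY kPLdY kCY kCtY kCLY kCDY kCLtY`, over the geometry `toB6 (geo9Y x) R H` and the block map `blkSK (sIK bI)` of the certificate, for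
contraction-pair transporters (the class input `‖U(b)‖, ‖U(b)⁻¹‖ ≤ 1`, displayed): ★★ `hasMajorant_pcoS_kPdY`, `hasMajorant_ptcoS_kPtdY`, `hasMajorant_plcoS_kPLdY`,
`hasMajorant_ccoS_kCY`, `hasMajorant_ctcoS_kCtY`, `hasMajorant_clcoS_kCLY`, `hasMajorant_cdcoS_kCDY`, `hasMajorant_cltcoS_kCLtY` (+ the instance-agnostic bookkeeping
`term_le`, `le_mul_loc`, `sum_avg_line_le`, `exists_of_avg_line_ne_zero`).  The record `opsWalkY` and the assembled `Identities₂` are part 3.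
HONEST SCOPE.  Part 2a + part 2b-I + `hasMajorant_mono`; the transporter hypotheses stay DISPLAYED (print: `U(b) ∈ G ⊂ U(N)`); no (3.42), no regime, nothing of [B9]'s
analysis asserted; count-neutral; N06 NOT discharged; nothing continuum ∕ OS ∕ mass gap ∕ Clay.  Cell `pub-ymgap` (D-0062), node N06 [B9], rows 18, seat
`pub-ymgap-dag-n06-d` (gen 14).  Net new unproved facts: 0.  NEW file.
-/

noncomputable section

namespace Literature.MathematicalPhysics.QuantumFieldTheory.Balaban1983to89.B9WalkLettersKernelsDom

open Node00
open Node00.OpsYLeibnizLetters (fdiffY bdiffY lapDiffY)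
open B6RandomWalk (HasMajorant hasMajorant_mono)
open B6KLevelCensusIndexV1 (KIdx)
open B6Ineq2142KLevelV1 (β lvl)
open B6Geom246MultiLevelBox (blkOf)
open B6Cover236MultiLevelBlocks (cubes)
open B9Thm34Ext (toB6)
open B9Thm37CubeCoverCommutators (hTY)
open B9Thm39ReadingCoords (cR39 cR39_nonneg coordBound39 basisBound39)
open B9Ineq349SiteComposite (etaS_pos)
open B9PinMembersKLevelV1 (MemberY geo9Y)
open B9GeoLemma21KLevelV1 (geo9Y_dist_comm)
open B9CoReadingCoordsS (XSK blkSK sIK)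
open B9CoordSliceMajorant (len_sIK_eq_lenB)
open B9WalkLettersCoordsS (SblkY)
open B9WalkLettersCoordsLeib (pcoS ptcoS plcoS ccoS ctcoS clcoS cdcoS cltcoS)
open B9WalkLettersCoordsDom (hasMajorant_pcoS hasMajorant_ptcoS hasMajorant_plcoS hasMajorant_ccoS hasMajorant_ctcoS hasMajorant_clcoS hasMajorant_cdcoS
  hasMajorant_cltcoS)
open B9WalkLettersKernels
open B9WalkLettersKernelsStatic

variable {d ℓ : ℕ} {hd : 1 ≤ d + 1} {hL : Odd (ℓ + 1) ∧ 1 < ℓ + 1} {b₀ b₁ : ℝ} {Mstar : ℕ}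

/-! ## The eight dominations of `Identities₂` at the kernels of record -/

section Dominations

variable {𝔸 : Type} [NormedRing 𝔸] [NormedAlgebra ℂ 𝔸] [CompleteSpace 𝔸] [FiniteDimensional ℝ 𝔸]
variable {κ : Type} [Fintype κ]
variable (x : MemberY d ℓ hd hL b₀ b₁ Mstar) (b : Module.Basis κ ℝ 𝔸) (B : B9.Backgrounds) (cfg : B.Cfg → CfgY 𝔸 x.toKIdx) (parS : SiteParY 𝔸 x.toKIdx)
variable {bI : FBondY x.toKIdx → IBondY x.toKIdx} [Fintype (geo9Y x).Site] (R : ℝ) (H : Prop)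

/-- one stencil term against one located unit: `|t|·𝟙[P] ≤ s·loc` when `|t| ≤ s`, `0 ≤ s`, `0 ≤ loc` and `t ≠ 0 ∧ P` force `loc = 1` (the decision
instance is taken from the goal). [cite: Balaban1984PropagatorsII, (2.51) p.232, bookkeeping] -/
theorem term_le {t s loc : ℝ} {P : Prop} {_ : Decidable P} (hs : |t| ≤ s) (hs0 : 0 ≤ s) (hloc : 0 ≤ loc) (h : t ≠ 0 → P → loc = 1) :
    |t| * (if P then (1 : ℝ) else 0) ≤ s * loc := by
  by_cases ht : t = 0
  · rw [ht, abs_zero, zero_mul]; exact mul_nonneg hs0 hloc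
  by_cases hP : P
  · rw [if_pos hP, mul_one, h ht hP, mul_one]; exact hs
  · rw [if_neg hP, mul_zero]; exact mul_nonneg hs0 hloc

/-- a located bound: `S ≤ B·loc` when `0 ≤ B`, `0 ≤ loc` and `S ≠ 0` forces both `S ≤ B` and `loc = 1`. [cite: Balaban1984PropagatorsII, (2.51) p.232, bookkeeping] -/
theorem le_mul_loc {S B loc : ℝ} (hB : 0 ≤ B) (hloc : 0 ≤ loc) (h1 : S ≠ 0 → S ≤ B) (h2 : S ≠ 0 → loc = 1) : S ≤ B * loc := by
  by_cases hs : S = 0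
  · rw [hs]; exact mul_nonneg hB hloc
  · rw [h2 hs, mul_one]; exact h1 hs

omit [CompleteSpace 𝔸] in
/-- `cbY` unfolded. [cite: Balaban1985BackgroundPropagators, (3.39)–(3.41) p.397, bookkeeping] -/
theorem cbY_eq : cbY b = coordBound39 b * basisBound39 b := rfl

omit [Fintype (geo9Y x).Site] in
/-- the averaging line at a site against the pinned weight: `Σ_{w : σ w = y′} |avgCoeffY(z,w)|·|h_□(z) − h_□(w)| ≤ (η∕ℓ(σ z))²·avgLipY` (the decision instance of
the fibre filter is taken from the goal). [cite: Balaban1985BackgroundPropagators, (3.88) p.409 (second line); Balaban1984PropagatorsII, (2.14) p.225, p.247] -/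
theorem sum_avg_line_le (hlev : ∀ f : FBondY x.toKIdx, lvl x.hN x.D x.hk (bI f) = (B6GlobalChartV1.blkV1 x.hN x.D f).1.1)
    (c : ↥(cubes x.toKIdx.D.toDomains)) (z : SiteY x.toKIdx) (y' : (geo9Y x).Site) {hdec : DecidablePred fun w : SiteY x.toKIdx => sIK x.toKIdx bI w = y'} :
    ∑ w ∈ @Finset.filter _ (fun w => sIK x.toKIdx bI w = y') hdec Finset.univ, |avgCoeffY x.toKIdx z w| * |hTY x.toKIdx c z - hTY x.toKIdx c w| ≤
      (etaS x.toKIdx / (geo9Y x).len (sIK x.toKIdx bI z)) ^ 2 * avgLipY x := by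
  have hA := avgLipY_nonneg x
  calc ∑ w ∈ @Finset.filter _ (fun w => sIK x.toKIdx bI w = y') hdec Finset.univ, |avgCoeffY x.toKIdx z w| * |hTY x.toKIdx c z - hTY x.toKIdx c w|
      ≤ ∑ w ∈ @Finset.filter _ (fun w => sIK x.toKIdx bI w = y') hdec Finset.univ, |avgCoeffY x.toKIdx z w| * avgLipY x :=
        Finset.sum_le_sum fun w _ => by
          by_cases hw : avgCoeffY x.toKIdx z w = 0
          · rw [hw, abs_zero, zero_mul, zero_mul]
          · exact mul_le_mul_of_nonneg_left (abs_sub_le_avgLipY x c hw) (abs_nonneg _)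
    _ = (∑ w ∈ @Finset.filter _ (fun w => sIK x.toKIdx bI w = y') hdec Finset.univ, |avgCoeffY x.toKIdx z w|) * avgLipY x := by rw [Finset.sum_mul]
    _ ≤ (∑ w, |avgCoeffY x.toKIdx z w|) * avgLipY x :=
        mul_le_mul_of_nonneg_right (Finset.sum_le_sum_of_subset_of_nonneg (Finset.filter_subset _ _) fun w _ _ => abs_nonneg _) hA
    _ ≤ ((((ℓ : ℝ) + 1) ^ levY x.toKIdx z) ^ 2)⁻¹ * avgLipY x := mul_le_mul_of_nonneg_right (sum_abs_avgCoeffY_le_inv_sq x z) hA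
    _ = (etaS x.toKIdx / (geo9Y x).len (sIK x.toKIdx bI z)) ^ 2 * avgLipY x := by rw [inv_sq_pow_levY_eq x bI hlev z]

omit [Fintype (geo9Y x).Site] in
/-- a non-zero averaging line has a block-mate witness: `w` with `σ w = y′`, `avgCoeffY(z,w) ≠ 0`, `h_□ z ≠ h_□ w`. [cite: Balaban1985BackgroundPropagators, (3.88) p.409, bookkeeping] -/
theorem exists_of_avg_line_ne_zero (c : ↥(cubes x.toKIdx.D.toDomains)) (z : SiteY x.toKIdx) (y' : (geo9Y x).Site)
    {hdec : DecidablePred fun w : SiteY x.toKIdx => sIK x.toKIdx bI w = y'}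
    (h : ∑ w ∈ @Finset.filter _ (fun w => sIK x.toKIdx bI w = y') hdec Finset.univ, |avgCoeffY x.toKIdx z w| * |hTY x.toKIdx c z - hTY x.toKIdx c w| ≠ 0) :
    ∃ w : SiteY x.toKIdx, sIK x.toKIdx bI w = y' ∧ avgCoeffY x.toKIdx z w ≠ 0 ∧ hTY x.toKIdx c z - hTY x.toKIdx c w ≠ 0 := by
  obtain ⟨w, hw, hne⟩ := Finset.exists_ne_zero_of_sum_ne_zero h
  rw [Finset.mem_filter] at hw
  rcases mul_ne_zero_iff.1 hne with ⟨h1, h2⟩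
  exact ⟨w, hw.2, abs_ne_zero.1 h1, abs_ne_zero.1 h2⟩

/-- ★★ **`Identities₂.hP` AT THE RECORD**: `P_□,μ` (`pcoS` at `h := h_□`) has the block majorant `KPd □ μ` on the site pin, for contraction-pair bond variables.
[cite: Balaban1985BackgroundPropagators, (3.88)–(3.89) p.409; Balaban1984PropagatorsII, (2.39)–(2.40) pp.229–230, (2.51) p.232] -/
theorem hasMajorant_pcoS_kPdY
    (hβ1 : ∀ f : FBondY x.toKIdx, (B6Geom246MultiLevelTorus.geomT x.D).dist (β x.hN x.D x.hk (bI f)) (B6GlobalChartV1.blkV1 x.hN x.D f) ≤ 1)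
    (c : ↥(cubes x.toKIdx.D.toDomains)) (μ : Fin (d + 1)) (U₁ : B.Cfg)
    (hU : ∀ w : SiteY x.toKIdx, ‖(UboxY x.toKIdx (cfg U₁) μ w : 𝔸)‖ ≤ 1 ∧ ‖(((UboxY x.toKIdx (cfg U₁) μ w)⁻¹ : 𝔸ˣ) : 𝔸)‖ ≤ 1) :
    HasMajorant (g := toB6 (geo9Y x) R H) (blkSK x.toKIdx (sIK x.toKIdx bI)) (pcoS x.toKIdx b B cfg U₁ (hTY x.toKIdx c) μ) (kPdY x b bI c μ) := by
  classical
  refine hasMajorant_mono _ (hasMajorant_pcoS x.toKIdx b B cfg (g := toB6 (geo9Y x) R H) (sIK x.toKIdx bI) U₁ (hTY x.toKIdx c) μ hU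
    (K := fun a y' => cbY b * (2 * stepY x c) * locY x bI c a y') (fun z y' => ?_)) (fun a y' => le_of_eq ?_)
  · rw [← cbY_eq, mul_assoc (cbY b)]
    refine mul_le_mul_of_nonneg_left ?_ (cbY_nonneg b)
    have hs := abs_fdiffY_bdiffY_le x c μ z
    have hst := dist_sIK_stencil x bI hβ1 μ z
    have hloc := (locY_nonneg_le_one x bI c (sIK x.toKIdx bI z) y').1
    refine le_trans (add_le_add (term_le hs.1 (stepY_nonneg x c) hloc fun ht e => ?_) (term_le hs.2 (stepY_nonneg x c) hloc fun ht e => ?_))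
      (le_of_eq (by ring))
    · rw [← e]; exact locY_eq_one x bI c (sIK_mem_SblkY_of_fdiffY_ne_zero x bI c μ ht).1 hst.1
    · rw [← e]; exact locY_eq_one x bI c (sIK_mem_SblkY_of_bdiffY_ne_zero x bI c μ ht).1 hst.2.2
  · simp only [kPdY, rowKY, coefPY]; ring

/-- ★★ **`Identities₂.hPt` AT THE RECORD**: `Pᵗ_□,μ` (`ptcoS`) has the column-type majorant `KPtd □ μ` (located at the input block).
[cite: Balaban1985BackgroundPropagators, (3.88)–(3.89) p.409 (transposed form); Balaban1984PropagatorsII, (2.39)–(2.40) pp.229–230, (2.51) p.232] -/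
theorem hasMajorant_ptcoS_kPtdY
    (hβ1 : ∀ f : FBondY x.toKIdx, (B6Geom246MultiLevelTorus.geomT x.D).dist (β x.hN x.D x.hk (bI f)) (B6GlobalChartV1.blkV1 x.hN x.D f) ≤ 1)
    (c : ↥(cubes x.toKIdx.D.toDomains)) (μ : Fin (d + 1)) (U₁ : B.Cfg)
    (hU : ∀ w : SiteY x.toKIdx, ‖(UboxY x.toKIdx (cfg U₁) μ w : 𝔸)‖ ≤ 1 ∧ ‖(((UboxY x.toKIdx (cfg U₁) μ w)⁻¹ : 𝔸ˣ) : 𝔸)‖ ≤ 1) :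
    HasMajorant (g := toB6 (geo9Y x) R H) (blkSK x.toKIdx (sIK x.toKIdx bI)) (ptcoS x.toKIdx b B cfg U₁ (hTY x.toKIdx c) μ) (kPtdY x b bI c μ) := by
  classical
  refine hasMajorant_mono _ (hasMajorant_ptcoS x.toKIdx b B cfg (g := toB6 (geo9Y x) R H) (sIK x.toKIdx bI) U₁ (hTY x.toKIdx c) μ hU
    (K := fun a y' => cbY b * (2 * stepY x c) * locY x bI c y' a) (fun z y' => ?_)) (fun a y' => le_of_eq ?_)
  · rw [← cbY_eq, mul_assoc (cbY b)]
    refine mul_le_mul_of_nonneg_left ?_ (cbY_nonneg b)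
    have hs := abs_fdiffY_bdiffY_le x c μ z
    have hst := dist_sIK_stencil x bI hβ1 μ z
    have hloc := (locY_nonneg_le_one x bI c y' (sIK x.toKIdx bI z)).1
    refine le_trans (add_le_add (term_le hs.1 (stepY_nonneg x c) hloc fun ht e => ?_) (term_le hs.1 (stepY_nonneg x c) hloc fun ht e => ?_))
      (le_of_eq (by ring))
    · rw [← e]
      refine locY_eq_one x bI c (sIK_mem_SblkY_of_fdiffY_ne_zero x bI c μ ht).2 ?_
      rw [geo9Y_dist_comm]; exact hst.2.1
    · rw [← e]; exact locY_eq_one x bI c (sIK_mem_SblkY_of_fdiffY_ne_zero x bI c μ ht).1 hst.1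
  · simp only [kPtdY, colKY, coefPY]; ring

/-- ★★ **`Identities₂.hPL` AT THE RECORD**: the Laplacian-Leibniz letter `P^L_□,μ` (`plcoS`) has the majorant `KPLd □ μ`.
[cite: Balaban1985BackgroundPropagators, (3.88) p.409, (3.100) p.413; Balaban1984PropagatorsII, (2.51) p.232] -/
theorem hasMajorant_plcoS_kPLdY
    (hβ1 : ∀ f : FBondY x.toKIdx, (B6Geom246MultiLevelTorus.geomT x.D).dist (β x.hN x.D x.hk (bI f)) (B6GlobalChartV1.blkV1 x.hN x.D f) ≤ 1)
    (c : ↥(cubes x.toKIdx.D.toDomains)) (μ : Fin (d + 1)) (U₁ : B.Cfg)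
    (hU : ∀ w : SiteY x.toKIdx, ‖(UboxY x.toKIdx (cfg U₁) μ w : 𝔸)‖ ≤ 1 ∧ ‖(((UboxY x.toKIdx (cfg U₁) μ w)⁻¹ : 𝔸ˣ) : 𝔸)‖ ≤ 1) :
    HasMajorant (g := toB6 (geo9Y x) R H) (blkSK x.toKIdx (sIK x.toKIdx bI)) (plcoS x.toKIdx b B cfg U₁ (hTY x.toKIdx c) μ) (kPLdY x b bI c μ) := by
  classical
  refine hasMajorant_mono _ (hasMajorant_plcoS x.toKIdx b B cfg (g := toB6 (geo9Y x) R H) (sIK x.toKIdx bI) U₁ (hTY x.toKIdx c) μ hU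
    (K := fun a y' => cbY b * (2 * stepY x c) * locY x bI c a y') (fun z y' => ?_)) (fun a y' => le_of_eq ?_)
  · rw [← cbY_eq, mul_assoc (cbY b)]
    refine mul_le_mul_of_nonneg_left ?_ (cbY_nonneg b)
    have hs := abs_fdiffY_bdiffY_le x c μ z
    have hst := dist_sIK_stencil x bI hβ1 μ z
    have hloc := (locY_nonneg_le_one x bI c (sIK x.toKIdx bI z) y').1
    refine le_trans (add_le_add (term_le hs.1 (stepY_nonneg x c) hloc fun ht e => ?_) (term_le hs.2 (stepY_nonneg x c) hloc fun ht e => ?_))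
      (le_of_eq (by ring))
    · rw [← e]; exact locY_eq_one x bI c (sIK_mem_SblkY_of_fdiffY_ne_zero x bI c μ ht).1 hst.1
    · rw [← e]; exact locY_eq_one x bI c (sIK_mem_SblkY_of_bdiffY_ne_zero x bI c μ ht).1 hst.2.2
  · simp only [kPLdY, rowKY, coefPLY]; ring

/-- ★★ **`Identities₂.hC` AT THE RECORD**: `C_□` (`ccoS` at `h := h_□`) has the block majorant `KC □`, for contraction-pair averaging transporters.
[cite: Balaban1985BackgroundPropagators, (3.88)–(3.89) p.409; Balaban1984PropagatorsII, (2.14) p.225, (2.39)–(2.40) pp.229–230, (2.51) p.232] -/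
theorem hasMajorant_ccoS_kCY
    (hβ1 : ∀ f : FBondY x.toKIdx, (B6Geom246MultiLevelTorus.geomT x.D).dist (β x.hN x.D x.hk (bI f)) (B6GlobalChartV1.blkV1 x.hN x.D f) ≤ 1)
    (hlev : ∀ f : FBondY x.toKIdx, lvl x.hN x.D x.hk (bI f) = (B6GlobalChartV1.blkV1 x.hN x.D f).1.1)
    (c : ↥(cubes x.toKIdx.D.toDomains)) (U₁ : B.Cfg)
    (hT : ∀ z w : SiteY x.toKIdx, ‖(avgTrY x.toKIdx parS (cfg U₁) z w : 𝔸)‖ ≤ 1 ∧ ‖(((avgTrY x.toKIdx parS (cfg U₁) z w)⁻¹ : 𝔸ˣ) : 𝔸)‖ ≤ 1) :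
    HasMajorant (g := toB6 (geo9Y x) R H) (blkSK x.toKIdx (sIK x.toKIdx bI)) (ccoS x.toKIdx b B cfg parS U₁ (hTY x.toKIdx c)) (kCY x b bI c) := by
  classical
  refine hasMajorant_mono _ (hasMajorant_ccoS x.toKIdx b B cfg parS (g := toB6 (geo9Y x) R H) (sIK x.toKIdx bI) U₁ (hTY x.toKIdx c) hT
    (K := fun a y' => cbY b * (((d : ℝ) + 1) * lapStepY x c + (etaS x.toKIdx / (geo9Y x).len a) ^ 2 * avgLipY x) * locY x bI c a y')
    (fun z y' => ?_)) (fun a y' => le_of_eq ?_)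
  · rw [← cbY_eq, mul_assoc (cbY b)]
    refine mul_le_mul_of_nonneg_left ?_ (cbY_nonneg b)
    have hloc := (locY_nonneg_le_one x bI c (sIK x.toKIdx bI z) y').1
    have hB0 : 0 ≤ (etaS x.toKIdx / (geo9Y x).len (sIK x.toKIdx bI z)) ^ 2 * avgLipY x := mul_nonneg (sq_nonneg _) (avgLipY_nonneg x)
    refine le_trans (add_le_add (term_le (abs_lapDiffY_le x c z) (mul_nonneg (by positivity) (lapStepY_nonneg x c)) hloc fun ht e => ?_)
      (le_mul_loc hB0 hloc (fun _ => ?_) fun hne => ?_)) (le_of_eq (by ring))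
    · rw [← e]; exact locY_eq_one x bI c (sIK_mem_SblkY_of_lapDiffY_ne_zero x bI c ht) (dist_sIK_stencil x bI hβ1 0 z).1
    · exact sum_avg_line_le x hlev c z y'
    · obtain ⟨w, hw, hne', hzw⟩ := exists_of_avg_line_ne_zero x c z y' hne
      rw [← hw]
      exact locY_eq_one x bI c (sIK_mem_SblkY_of_avg x bI c hne' hzw).1
        (by linarith [dist_sIK_le_two_of_blkOf_eq x bI hβ1 (blkOf_eq_of_avgCoeffY_ne_zero x hne')])
  · simp only [kCY, rowKY, coefCY]; ring

/-- ★★ **`Identities₂.hCt` AT THE RECORD**: `Cᵗ_□` (`ctcoS`) has the column-type majorant `KCt □` (coefficient and indicator at the input block; a block-mate of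
`z` has the level of `z`). [cite: Balaban1985BackgroundPropagators, (3.88)–(3.89) p.409 (transposed form); Balaban1984PropagatorsII, (2.14) p.225, (2.51) p.232] -/
theorem hasMajorant_ctcoS_kCtY
    (hβ1 : ∀ f : FBondY x.toKIdx, (B6Geom246MultiLevelTorus.geomT x.D).dist (β x.hN x.D x.hk (bI f)) (B6GlobalChartV1.blkV1 x.hN x.D f) ≤ 1)
    (hlev : ∀ f : FBondY x.toKIdx, lvl x.hN x.D x.hk (bI f) = (B6GlobalChartV1.blkV1 x.hN x.D f).1.1)
    (c : ↥(cubes x.toKIdx.D.toDomains)) (U₁ : B.Cfg)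
    (hT : ∀ z w : SiteY x.toKIdx, ‖(avgTrY x.toKIdx parS (cfg U₁) z w : 𝔸)‖ ≤ 1 ∧ ‖(((avgTrY x.toKIdx parS (cfg U₁) z w)⁻¹ : 𝔸ˣ) : 𝔸)‖ ≤ 1) :
    HasMajorant (g := toB6 (geo9Y x) R H) (blkSK x.toKIdx (sIK x.toKIdx bI)) (ctcoS x.toKIdx b B cfg parS U₁ (hTY x.toKIdx c)) (kCtY x b bI c) := by
  classical
  refine hasMajorant_mono _ (hasMajorant_ctcoS x.toKIdx b B cfg parS (g := toB6 (geo9Y x) R H) (sIK x.toKIdx bI) U₁ (hTY x.toKIdx c) hT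
    (K := fun a y' => cbY b * (((d : ℝ) + 1) * lapStepY x c + (etaS x.toKIdx / (geo9Y x).len y') ^ 2 * avgLipY x) * locY x bI c y' a)
    (fun z y' => ?_)) (fun a y' => le_of_eq ?_)
  · rw [← cbY_eq, mul_assoc (cbY b)]
    refine mul_le_mul_of_nonneg_left ?_ (cbY_nonneg b)
    have hloc := (locY_nonneg_le_one x bI c y' (sIK x.toKIdx bI z)).1
    have hB0 : 0 ≤ (etaS x.toKIdx / (geo9Y x).len y') ^ 2 * avgLipY x := mul_nonneg (sq_nonneg _) (avgLipY_nonneg x)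
    refine le_trans (add_le_add (term_le (abs_lapDiffY_le x c z) (mul_nonneg (by positivity) (lapStepY_nonneg x c)) hloc fun ht e => ?_)
      (le_mul_loc hB0 hloc (fun hne => ?_) fun hne => ?_)) (le_of_eq (by ring))
    · rw [← e]; exact locY_eq_one x bI c (sIK_mem_SblkY_of_lapDiffY_ne_zero x bI c ht) (dist_sIK_stencil x bI hβ1 0 z).1
    · -- the pinned length of `y′ = σ w` is that of `σ z` (same block)
      obtain ⟨w, hw, hne', -⟩ := exists_of_avg_line_ne_zero x c z y' hne
      have hb := blkOf_eq_of_avgCoeffY_ne_zero x hne'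
      have hlen : (geo9Y x).len y' = (geo9Y x).len (sIK x.toKIdx bI z) := by
        rw [← hw, len_sIK_eq_lenB x hlev w, len_sIK_eq_lenB x hlev z, hb]
      rw [hlen]
      exact sum_avg_line_le x hlev c z y'
    · obtain ⟨w, hw, hne', hzw⟩ := exists_of_avg_line_ne_zero x c z y' hne
      have hb := blkOf_eq_of_avgCoeffY_ne_zero x hne'
      rw [← hw]
      exact locY_eq_one x bI c (sIK_mem_SblkY_of_avg x bI c hne' hzw).2
        (by linarith [dist_sIK_le_two_of_blkOf_eq x bI hβ1 (z := w) (w := z) hb.symm])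
  · simp only [kCtY, colKY, coefCY]; ring

omit [CompleteSpace 𝔸] in
/-- ★★ **`Identities₂.hCL` AT THE RECORD**: `C^L_□ = −η⁻²M_{Δh_□}` (`clcoS`) has the majorant `KCL □`.
[cite: Balaban1985BackgroundPropagators, (3.88) p.409, (3.100) p.413; Balaban1984PropagatorsII, (2.51) p.232] -/
theorem hasMajorant_clcoS_kCLY
    (hβ1 : ∀ f : FBondY x.toKIdx, (B6Geom246MultiLevelTorus.geomT x.D).dist (β x.hN x.D x.hk (bI f)) (B6GlobalChartV1.blkV1 x.hN x.D f) ≤ 1)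
    (c : ↥(cubes x.toKIdx.D.toDomains)) :
    HasMajorant (g := toB6 (geo9Y x) R H) (blkSK x.toKIdx (sIK x.toKIdx bI)) (clcoS (𝔸 := 𝔸) x.toKIdx b (hTY x.toKIdx c)) (kCLY x b bI c) := by
  classical
  refine hasMajorant_mono _ (hasMajorant_clcoS x.toKIdx b (g := toB6 (geo9Y x) R H) (sIK x.toKIdx bI) (hTY x.toKIdx c)
    (K := fun a y' => cbY b * (((d : ℝ) + 1) * lapStepY x c) * locY x bI c a y') (fun z y' => ?_)) (fun a y' => le_of_eq ?_)
  · rw [← cbY_eq, mul_assoc (cbY b)]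
    refine mul_le_mul_of_nonneg_left ?_ (cbY_nonneg b)
    exact term_le (abs_lapDiffY_le x c z) (mul_nonneg (by positivity) (lapStepY_nonneg x c))
      (locY_nonneg_le_one x bI c (sIK x.toKIdx bI z) y').1
      (fun ht e => by rw [← e]; exact locY_eq_one x bI c (sIK_mem_SblkY_of_lapDiffY_ne_zero x bI c ht) (dist_sIK_stencil x bI hβ1 0 z).1)
  · simp only [kCLY, rowKY, coefCLY]; ring

/-- ★★ **`Identities₂.hCD` AT THE RECORD**: the `∇`-Leibniz letter `C^D(U,h_□)` (`cdcoS`, slices `ν`) has the majorant `KCD □`.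
[cite: Balaban1985BackgroundPropagators, (3.100) p.413; Balaban1984PropagatorsII, (2.39) p.229, (2.51) p.232] -/
theorem hasMajorant_cdcoS_kCDY
    (hβ1 : ∀ f : FBondY x.toKIdx, (B6Geom246MultiLevelTorus.geomT x.D).dist (β x.hN x.D x.hk (bI f)) (B6GlobalChartV1.blkV1 x.hN x.D f) ≤ 1)
    (c : ↥(cubes x.toKIdx.D.toDomains)) (U₁ : B.Cfg)
    (hU : ∀ (ν : Fin (d + 1)) (w : SiteY x.toKIdx), ‖(UboxY x.toKIdx (cfg U₁) ν w : 𝔸)‖ ≤ 1 ∧ ‖(((UboxY x.toKIdx (cfg U₁) ν w)⁻¹ : 𝔸ˣ) : 𝔸)‖ ≤ 1) :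
    HasMajorant (g := toB6 (geo9Y x) R H) (blkSK x.toKIdx (sIK x.toKIdx bI)) (cdcoS x.toKIdx b B cfg U₁ (hTY x.toKIdx c)) (kCDY x b bI c) := by
  classical
  refine hasMajorant_mono _ (hasMajorant_cdcoS x.toKIdx b B cfg (g := toB6 (geo9Y x) R H) (sIK x.toKIdx bI) U₁ (hTY x.toKIdx c) hU
    (K := fun a y' => cbY b * (((d : ℝ) + 1) * stepY x c) * locY x bI c a y') (fun z y' => ?_)) (fun a y' => le_of_eq ?_)
  · rw [← cbY_eq, mul_assoc (cbY b)]
    refine mul_le_mul_of_nonneg_left ?_ (cbY_nonneg b)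
    have hloc := (locY_nonneg_le_one x bI c (sIK x.toKIdx bI z) y').1
    refine le_trans (b := ∑ _ν : Fin (d + 1), stepY x c * locY x bI c (sIK x.toKIdx bI z) y')
      (Finset.sum_le_sum fun ν _ => term_le (abs_fdiffY_bdiffY_le x c ν z).1 (stepY_nonneg x c) hloc fun ht e => ?_) (le_of_eq ?_)
    · rw [← e]; exact locY_eq_one x bI c (sIK_mem_SblkY_of_fdiffY_ne_zero x bI c ν ht).1 (dist_sIK_stencil x bI hβ1 ν z).2.1
    · rw [Finset.sum_const, Finset.card_univ, Fintype.card_fin, nsmul_eq_mul]; push_cast; ring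
  · simp only [kCDY, rowKY, coefCDY]; ring

/-- ★★ **`Identities₂.hCLt` AT THE RECORD**: the right `∇*`-Leibniz letter `C^{Lt}(U,h_□)` (`cltcoS`) has the column-type majorant `KCLt □`.
[cite: Balaban1985BackgroundPropagators, (3.100) p.413, (3.8) p.392; Balaban1984PropagatorsII, (2.51) p.232] -/
theorem hasMajorant_cltcoS_kCLtY
    (hβ1 : ∀ f : FBondY x.toKIdx, (B6Geom246MultiLevelTorus.geomT x.D).dist (β x.hN x.D x.hk (bI f)) (B6GlobalChartV1.blkV1 x.hN x.D f) ≤ 1)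
    (c : ↥(cubes x.toKIdx.D.toDomains)) (U₁ : B.Cfg)
    (hU : ∀ (ν : Fin (d + 1)) (w : SiteY x.toKIdx), ‖(UboxY x.toKIdx (cfg U₁) ν w : 𝔸)‖ ≤ 1 ∧ ‖(((UboxY x.toKIdx (cfg U₁) ν w)⁻¹ : 𝔸ˣ) : 𝔸)‖ ≤ 1) :
    HasMajorant (g := toB6 (geo9Y x) R H) (blkSK x.toKIdx (sIK x.toKIdx bI)) (cltcoS x.toKIdx b B cfg U₁ (hTY x.toKIdx c)) (kCLtY x b bI c) := by
  classical
  refine hasMajorant_mono _ (hasMajorant_cltcoS x.toKIdx b B cfg (g := toB6 (geo9Y x) R H) (sIK x.toKIdx bI) U₁ (hTY x.toKIdx c) hU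
    (K := fun a y' => cbY b * (((d : ℝ) + 1) * stepY x c) * locY x bI c y' a) (fun z y' => ?_)) (fun a y' => le_of_eq ?_)
  · rw [← cbY_eq, mul_assoc (cbY b)]
    refine mul_le_mul_of_nonneg_left ?_ (cbY_nonneg b)
    have hloc := (locY_nonneg_le_one x bI c y' (sIK x.toKIdx bI z)).1
    refine le_trans (b := ∑ _ν : Fin (d + 1), stepY x c * locY x bI c y' (sIK x.toKIdx bI z))
      (Finset.sum_le_sum fun ν _ => term_le (abs_fdiffY_bdiffY_le x c ν z).2 (stepY_nonneg x c) hloc fun ht e => ?_) (le_of_eq ?_)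
    · rw [← e]
      refine locY_eq_one x bI c (sIK_mem_SblkY_of_bdiffY_ne_zero x bI c ν ht).2 ?_
      rw [geo9Y_dist_comm]; exact (dist_sIK_stencil x bI hβ1 ν z).2.2
    · rw [Finset.sum_const, Finset.card_univ, Fintype.card_fin, nsmul_eq_mul]; push_cast; ring
  · simp only [kCLtY, colKY, coefCDY]; ring

end Dominations

end Literature.MathematicalPhysics.QuantumFieldTheory.Balaban1983to89.B9WalkLettersKernelsDom

end
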